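import Literature.AnabelianGeometry.SemiGraphs.TemperoidsResProofs
import Literature.AnabelianGeometry.SemiGraphs.TemperoidsHomEqResProofs
import Literature.AnabelianGeometry.SemiGraphs.ConnectedPartEquivExtension
import Literature.AnabelianGeometry.EtaleTheta.Discharge.Sec4GaloisSurjNaturalModel

/-!
# A self-equivalence of `B^temp(Π)⁰` is `B^temp(φ)` for a topological AUTOMORPHISM `φ` of `Π`, and its shadow on the Galois
# surjections `Π ↠ Aut(A)` is the inner-twisted `φ⁻¹` ([SemiAnbd] Prop. 3.2; [EtTh] Def. 4.1 (ii), Prop. 2.4 setting)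

Mochizuki, *Semi-graphs of anabelioids*, Publ. RIMS **42** (2006), Prop. 3.2 p.35 [cite: MochizukiSemiAnbd2006, Prop 3.2 p.35]
("the category of morphisms `B^temp(Π₁) → B^temp(Π₂)` is equivalent to the category of continuous outer homomorphisms");
*The étale theta function …*, Publ. RIMS **45** (2009), Def. 4.1 (ii) p.313 (PDF p.87) (the "natural surjective outer
homomorphism `Π^tp_X ↠ Aut_D(A)`" of a Galois object) and §5 p.334 (PDF p.108) ("the automorphism of `Π^tp_X` induced by `Ψ`
[cf. Theorem 4.4 (i)]") [cite: MochizukiEtTh2009, Def 4.1 p.313 (PDF p.87)].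

PROOF-ONLY (no definitions).  Seat abc-iut-L2-d4 (gen 4), L2-lead row R190 «(γ, hγ)»: the producer of the pair
(γ : Π^tp_X ≃ₜ* Π^tp_X, hγ : θ ∘ ρ = ρ ∘ γ) consumed by abc-iut-w5-d245's `ThetaFrobenioid.HB_map_mulEquiv_eq_of_galoisShadow`
(then `hYdd` ⟸ [EtTh] Prop. 2.4 for γ BY NAME), for the base shadow θ of a self-equivalence of the tempered Frobenioid.
* `BTemp.exists_continuousMulEquiv_iso_res` — for `Π` tempered and second countable, every self-equivalence `E` of `B^temp(Π)`
  satisfies `E ≅ B^temp(φ)` for a topological AUTOMORPHISM `φ` of `Π`: [SemiAnbd] Prop. 3.2 surjectivity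
  (`TemperoidHomEqRes_holds`, abc-iut-L3-d2) for `E` and `E⁻¹`, then injectivity (`ResIsoResIff_holds`) on
  `B^temp(φ ∘ ψ) ≅ 𝟭 ≅ B^temp(ψ ∘ φ)` makes both composites inner, whence `φ` is bijective with continuous inverse;
* `GaloisObjects.exists_conj_eq_galoisSurjOf_of_iso_res` — THE SHADOW: if `E ≅ B^temp(φ)` and `ι : E(A) ⥲ A` for a Galois
  object `A`, then `ι⁻¹ ∘ E(ρ_A(g)) ∘ ι = ρ_A(φ⁻¹(k g k⁻¹))` for one `k ∈ Π` and all `g` (`ρ_A = galoisSurjOf`): conjugating the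
  Galois surjection by the identification is the Galois surjection precomposed with the topological automorphism `φ⁻¹ ∘ Inn(k)`;
* `GaloisObjects.exists_galoisShadow_of_equivalence` / `…_connectedPart` — the same for a self-equivalence of `B^temp(Π)`, resp. of
  the CONNECTED PART `B^temp(Π)⁰` (the base category `D` of [EtTh] §3–§5; extension to `B^temp(Π)` by abc-iut-w5-d013's
  `BTemp.exists_equivalence_extension`), with the Galois surjection transported to the full subcategory exactly as in
  abc-iut-L2-t4's `BiKummerSetting.mkOfConnectedTemperoid`: `∃ γ : Π ≃ₜ* Π, ∀ g, κ⁻¹ ∘ E⁰(ρ_A g) ∘ κ = ρ_A (γ g)`.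
Classical ([SemiAnbd] §3 + bookkeeping); nothing of the disputed series is asserted; no side taken on anything downstream.
-/

noncomputable section

open CategoryTheory Topology

namespace Literature.AnabelianGeometry.SemiGraphs

open Literature.AlgebraicGeometry.Frobenioids (IsConnectedObj ConnectedPart connectedObjects)
open Literature.AlgebraicGeometry.Frobenioids.QuasiTemperoid.BTempConnected

universe u

variable {G : Type u} [Group G] [TopologicalSpace G] [IsTopologicalGroup G]

/-! ### A self-equivalence of `B^temp(Π)` is `B^temp(φ)` for an automorphism `φ` -/

namespace BTemp

/-- **[SemiAnbd] Prop. 3.2 for a self-EQUIVALENCE**: for `Π` tempered and second countable and `E : B^temp(Π) ≌ B^temp(Π)`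
there is a topological automorphism `φ : Π ≃ₜ* Π` with `E ≅ B^temp(φ)` (pull-back along `φ`).  (Surjectivity half of
Prop. 3.2 for `E` and `E⁻¹`; injectivity half on the two composites, which are therefore inner; an endomorphism that is
surjective up to one inner automorphism and injective up to another is an automorphism, with continuous inverse
`y ↦ ψ(g⁻¹ y g)`.)  [cite: MochizukiSemiAnbd2006, Prop 3.2 p.35] -/
theorem exists_continuousMulEquiv_iso_res [SecondCountableTopology G] (hG : IsTempered G) (E : BTemp G ≌ BTemp G) :
    ∃ φ : G ≃ₜ* G, Nonempty (E.functor ≅ BTemp.res (φ : G →ₜ* G)) := by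
  obtain ⟨φ, ⟨ηφ⟩⟩ := TemperoidHomEqRes_holds G G hG hG ⟨E.functor, inferInstance, fun _ _ _ => inferInstance⟩
  obtain ⟨ψ, ⟨ηψ⟩⟩ := TemperoidHomEqRes_holds G G hG hG ⟨E.inverse, inferInstance, fun _ _ _ => inferInstance⟩
  -- `B^temp(id) = 𝟭 ≅ E ⋙ E⁻¹ ≅ B^temp(φ) ⋙ B^temp(ψ) = B^temp(φ ∘ ψ)`, and symmetrically
  have h1 : Nonempty (BTemp.res (ContinuousMonoidHom.id G) ≅ BTemp.res (φ.comp ψ)) :=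
    ⟨E.unitIso ≪≫ Functor.isoWhiskerRight ηφ E.inverse ≪≫ Functor.isoWhiskerLeft (BTemp.res φ) ηψ⟩
  have h2 : Nonempty (BTemp.res (ψ.comp φ) ≅ BTemp.res (ContinuousMonoidHom.id G)) :=
    ⟨(Functor.isoWhiskerRight ηψ E.functor ≪≫ Functor.isoWhiskerLeft (BTemp.res ψ) ηφ).symm ≪≫ E.counitIso⟩
  obtain ⟨g, hg⟩ := (ResIsoResIff_holds G G hG hG (ContinuousMonoidHom.id G) (φ.comp ψ)).mp h1
  obtain ⟨g', hg'⟩ := (ResIsoResIff_holds G G hG hG (ψ.comp φ) (ContinuousMonoidHom.id G)).mp h2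
  -- `φ (ψ x) = g x g⁻¹` and `g' ψ (φ x) g'⁻¹ = x`
  have hsurj : ∀ y : G, φ (ψ (g⁻¹ * y * g)) = y := fun y => by
    have := hg (g⁻¹ * y * g)
    change g * (g⁻¹ * y * g) * g⁻¹ = φ (ψ (g⁻¹ * y * g)) at this
    rw [← this]; group
  have hinj : Function.Injective φ := fun a b hab => by
    have ha := hg' a
    have hb := hg' b
    change g' * ψ (φ a) * g'⁻¹ = a at ha
    change g' * ψ (φ b) * g'⁻¹ = b at hb
    rw [← ha, ← hb, hab]
  let e : G ≃* G :=
    { toFun := φ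
      invFun := fun y => ψ (g⁻¹ * y * g)
      left_inv := fun x => hinj (hsurj (φ x))
      right_inv := hsurj
      map_mul' := map_mul φ }
  refine ⟨{ e with
      continuous_toFun := φ.continuous
      continuous_invFun := ψ.continuous.comp ((continuous_const.mul continuous_id).mul continuous_const) }, ⟨?_⟩⟩
  have hφ : ((({ e with
      continuous_toFun := φ.continuous
      continuous_invFun := ψ.continuous.comp ((continuous_const.mul continuous_id).mul continuous_const) } :
        G ≃ₜ* G) : G →ₜ* G)) = φ := ContinuousMonoidHom.ext fun _ => rfl
  rw [hφ]
  exact ηφ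

end BTemp

/-! ### The shadow of `E ≅ B^temp(φ)` on the Galois surjection of a Galois object -/

namespace GaloisObjects

variable (hG : IsTempered G)

/-- **The Galois shadow of a functor isomorphic to `B^temp(φ)`.**  Let `φ` be a topological automorphism of `Π`, `E` a functor
with `η : E ≅ B^temp(φ)`, `A` a Galois object with Galois surjection `ρ_A : Π ↠ Aut(A)` (`galoisSurjOf`, base point `x_A`) and
`ι : E(A) ⥲ A`.  Write `j := η_A⁻¹ ≫ ι : A^φ ⥲ A` (`A^φ` = `A` with the action twisted by `φ`) and `j⁻¹(x_A) = k·x_A`.  Then for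
every `g ∈ Π`: `ι⁻¹ ∘ E(ρ_A(g)) ∘ ι = ρ_A(φ⁻¹(k g k⁻¹))` — both sides are automorphisms of the connected object `A` sending
`x_A ↦ φ⁻¹(k g⁻¹ k⁻¹)·x_A`.  [cite: MochizukiEtTh2009, Def 4.1 p.313 (PDF p.87)] -/
theorem exists_conj_eq_galoisSurjOf_of_iso_res (φ : G ≃ₜ* G) {E : BTemp G ⥤ BTemp G}
    (η : E ≅ BTemp.res (φ : G →ₜ* G)) (A : BTemp G) (hA : IsGaloisObj A) (ι : E.obj A ≅ A) :
    ∃ k : G, ∀ g : G,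
      ι.symm ≪≫ E.mapIso (galoisSurjOf hG A hA g) ≪≫ ι = galoisSurjOf hG A hA (φ.symm (k * g * k⁻¹)) := by
  -- `j : A^φ ⟶ A` and `j' : A ⟶ A^φ`, mutually inverse
  set j : (BTemp.res (φ : G →ₜ* G)).obj A ⟶ A := η.inv.app A ≫ ι.hom with hjdef
  set j' : A ⟶ (BTemp.res (φ : G →ₜ* G)).obj A := ι.inv ≫ η.hom.app A with hj'def
  have hjj : ∀ x : A.obj.V, (j.hom.hom (j'.hom.hom x) : A.obj.V) = x := fun x => by
    rw [← comp_apply, hj'def, hjdef, Category.assoc, ← Category.assoc (η.hom.app A), ← NatTrans.comp_app,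
      Iso.hom_inv_id, NatTrans.id_app, Category.id_comp, Iso.inv_hom_id, id_apply]
  -- the point `k·x_A := j'(x_A)`
  obtain ⟨k, hk⟩ := exists_ρ_galoisBase_eq hG A hA (j'.hom.hom (galoisBase hG A hA) : A.obj.V)
  refine ⟨k, fun g => aut_eq_of_apply_eq hA.1 _ _ (galoisBase hG A hA) ?_⟩
  -- `E(σ) = η_A ≫ B^temp(φ)(σ) ≫ η_A⁻¹`
  have hnat : E.map (galoisSurjOf hG A hA g).hom =
      η.hom.app A ≫ (BTemp.res (φ : G →ₜ* G)).map (galoisSurjOf hG A hA g).hom ≫ η.inv.app A := by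
    rw [← Category.assoc, ← η.hom.naturality, Category.assoc, Iso.hom_inv_id_app, Category.comp_id]
  have hσ : (ι.symm ≪≫ E.mapIso (galoisSurjOf hG A hA g) ≪≫ ι).hom =
      j' ≫ (BTemp.res (φ : G →ₜ* G)).map (galoisSurjOf hG A hA g).hom ≫ j := by
    rw [Iso.trans_hom, Iso.trans_hom, Iso.symm_hom, Functor.mapIso_hom, hnat, hjdef, hj'def]
    simp only [Category.assoc]
  -- equivariance of `j` read from `A^φ` to `A`: `j (φ h · y) = h · j y`
  have hj : ∀ (h : G) (y : ((BTemp.res (φ : G →ₜ* G)).obj A).obj.V),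
      (j.hom.hom (A.obj.ρ (φ h) y) : A.obj.V) = A.obj.ρ h (j.hom.hom y) := fun h y => hom_ρ j h y
  -- evaluate both sides on `x_A`
  rw [hσ, comp_apply, comp_apply]
  change (j.hom.hom ((galoisSurjOf hG A hA g).hom.hom.hom (j'.hom.hom (galoisBase hG A hA))) : A.obj.V) = _
  rw [← hk, galoisSurjOf_apply, galoisSurjOf_apply_base,
    show k * g⁻¹ = φ (φ.symm (k * g⁻¹ * k⁻¹)) * k by rw [ContinuousMulEquiv.apply_symm_apply]; group,
    ρ_mul_apply, hj, hk, hjj, ← map_inv φ.symm, show (k * g * k⁻¹)⁻¹ = k * g⁻¹ * k⁻¹ by group]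

/-- **The Galois shadow of a self-equivalence of `B^temp(Π)`**: for `Π` tempered and second countable, `E : B^temp(Π) ≌ B^temp(Π)`,
a Galois object `A` and `ι : E(A) ⥲ A`, there is a topological automorphism `γ` of `Π` (namely `φ⁻¹ ∘ Inn(k)` for the `φ` of
`BTemp.exists_continuousMulEquiv_iso_res`) with `ι⁻¹ ∘ E(ρ_A(g)) ∘ ι = ρ_A(γ g)` for all `g` — "the automorphism of `Π^tp_X`
induced by `Ψ`" read on `Aut_D(A)`.  [cite: MochizukiEtTh2009, Def 4.1 p.313 (PDF p.87)] -/
theorem exists_galoisShadow_of_equivalence [SecondCountableTopology G] (E : BTemp G ≌ BTemp G) (A : BTemp G)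
    (hA : IsGaloisObj A) (ι : E.functor.obj A ≅ A) :
    ∃ γ : G ≃ₜ* G, ∀ g : G, ι.symm ≪≫ E.functor.mapIso (galoisSurjOf hG A hA g) ≪≫ ι = galoisSurjOf hG A hA (γ g) := by
  obtain ⟨φ, ⟨η⟩⟩ := BTemp.exists_continuousMulEquiv_iso_res hG E
  obtain ⟨k, hk⟩ := exists_conj_eq_galoisSurjOf_of_iso_res hG φ η A hA ι
  let c : G ≃ₜ* G :=
    { MulAut.conj k with
      continuous_toFun := (continuous_const.mul continuous_id).mul continuous_const
      continuous_invFun := (continuous_const.mul continuous_id).mul continuous_const }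
  exact ⟨c.trans φ.symm, fun g => hk g⟩

/-- **The Galois shadow of a self-equivalence of the CONNECTED PART `B^temp(Π)⁰`** (the base category `D` of [EtTh] §3–§5):
for `E⁰ : B^temp(Π)⁰ ⥤ B^temp(Π)⁰` an equivalence, `A` a Galois object of `B^temp(Π)⁰` (i.e. its underlying `Π`-set is Galois),
`κ : E⁰(A) ⥲ A`, and the Galois surjection `Π ↠ Aut(A)` transported to the full subcategory along `Aut(A) ≃ Aut(A_{B^temp})`
(verbatim as in abc-iut-L2-t4's `BiKummerSetting.mkOfConnectedTemperoid`), there is a topological automorphism `γ` of `Π` with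
`κ⁻¹ ∘ E⁰(ρ_A g) ∘ κ = ρ_A(γ g)` for all `g` (extend `E⁰` to `B^temp(Π)` by abc-iut-w5-d013's `BTemp.exists_equivalence_extension`,
then `exists_galoisShadow_of_equivalence`).  [cite: MochizukiEtTh2009, Def 4.1 p.313 (PDF p.87)] -/
theorem exists_galoisShadow_of_equivalence_connectedPart [SecondCountableTopology G]
    (E₀ : ConnectedPart (BTemp G) ⥤ ConnectedPart (BTemp G)) [E₀.IsEquivalence] (A : ConnectedPart (BTemp G))
    (hA : IsGaloisObj A.obj) (κ : E₀.obj A ≅ A) :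
    ∃ γ : G ≃ₜ* G, ∀ g : G,
      κ.symm ≪≫ E₀.mapIso (((connectedObjects (BTemp G)).fullyFaithfulι.autMulEquivOfFullyFaithful A).symm
          (galoisSurjOf hG A.obj hA g)) ≪≫ κ =
        ((connectedObjects (BTemp G)).fullyFaithfulι.autMulEquivOfFullyFaithful A).symm (galoisSurjOf hG A.obj hA (γ g)) := by
  obtain ⟨E, ⟨e⟩⟩ := BTemp.exists_equivalence_extension E₀.asEquivalence
  -- the identification at the level of `B^temp(Π)`: `E(A) ≅ E₀(A) ≅ A`
  set ιA : E.functor.obj A.obj ≅ A.obj := (e.app A).symm ≪≫ (connectedObjects (BTemp G)).ι.mapIso κ with hιA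
  obtain ⟨γ, hγ⟩ := exists_galoisShadow_of_equivalence hG E A.obj hA ιA
  refine ⟨γ, fun g => ?_⟩
  set σt : Aut A := ((connectedObjects (BTemp G)).fullyFaithfulι.autMulEquivOfFullyFaithful A).symm
    (galoisSurjOf hG A.obj hA g) with hσt
  have hmap : ∀ τ : Aut A, ((connectedObjects (BTemp G)).fullyFaithfulι.autMulEquivOfFullyFaithful A) τ =
      (connectedObjects (BTemp G)).ι.mapIso τ := fun τ => rfl
  -- `σ̃ := ρ_A(g)` read in the full subcategory maps to `σ := galoisSurjOf g`
  have hσ : (connectedObjects (BTemp G)).ι.mapIso σt = galoisSurjOf hG A.obj hA g := by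
    rw [← hmap, hσt, MulEquiv.apply_symm_apply]
  have hσ' : (connectedObjects (BTemp G)).ι.map σt.hom = (galoisSurjOf hG A.obj hA g).hom := congrArg Iso.hom hσ
  -- naturality of `e : E₀ ⋙ ι ≅ ι ⋙ E` on `σ̃`
  have hnat : (connectedObjects (BTemp G)).ι.map (E₀.map σt.hom) =
      e.hom.app A ≫ E.functor.map (galoisSurjOf hG A.obj hA g).hom ≫ e.inv.app A := by
    have h := e.hom.naturality σt.hom =≫ e.inv.app A
    rw [Functor.comp_map, Functor.comp_map, hσ'] at h
    simp only [Category.assoc, Iso.hom_inv_id_app, Category.comp_id] at h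
    exact h
  -- compare after applying the faithful inclusion `B^temp(Π)⁰ ⥤ B^temp(Π)`
  apply ((connectedObjects (BTemp G)).fullyFaithfulι.autMulEquivOfFullyFaithful A).injective
  rw [MulEquiv.apply_symm_apply, hmap, ← hγ g]
  refine Iso.ext ?_
  simp only [Functor.mapIso_hom, Iso.trans_hom, Iso.symm_hom, Functor.map_comp, hnat, hιA, Iso.trans_inv, Iso.symm_inv,
    Functor.mapIso_inv, Iso.app_hom, Iso.app_inv, Category.assoc]
  rfl

end GaloisObjects

end Literature.AnabelianGeometry.SemiGraphs

end
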